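import Summits.ValiantsHypothesis.ValiantsHypothesis.Theorems.KPlusLogSqLawTropicalSymmetricThreeFourSixteenLemmas

/-!
# Route «KPlusLogSqLaw» — the SYMMETRIC `(3,4)` tropical row sharpened again: `T_sym(3,4) ≤ 16` ON EVERY SUPPORT, by a third
# face-free exclusion (two quantitative cancellation inequalities that cannot hold together)

HONEST FRAMING.  Helper file (seat val-sym-lift-p2 (g5), cell `pub-symmetroid`, 2026-08-27; `--supports` the `WeakLifting` item
stmt-ValiantsHypothesis-19561 as a helper, no closure claim).  A SMALL-FORMAT statement in the single-term-carrier model, far inside the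
known regime of the cruxes; nothing here is about `TropicalB` / `WeakLifting` in their windows, Conjecture B, the real census numeral of
Door A at `(3,4)` (`PosRootLawAt 3 4 18`, OPEN, never asserted), `MatrixDescartes` (stmt-ValiantsHypothesis-18050) or VP ≠ VNP.  Kernel
window after this file: `15 ≤ T^single_sym(3,4) ≤ 16` (floor p469079; cell level `= 15`, two codes; the last unit needs the sign rules).

STATEMENT (`tropRow_three_four_symm_le_sixteen`, the EXACT shape of `tropRow_three_four_symm_le` with `16`).

PROOF (face-free).  Classes by exponent rank; carriers `D(u)` (identity) or crossing terms; rules: single-entry exchange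
(`d_lt_of_dominant_entry`), crossing cancellation in both orders (`d_add_d_lt_of_dominant_cross`), distinct multisets
(`slope_lt_of_dominant`).  LEMMA X (as in `…Seventeen`): `{003}` excludes `{012}`, `{033}` excludes `{123}` — two misses.  LEMMA Y:
`{013}` (= `D(u)`) and `{112}` both carried ⇒ `g 0 + g 3 < 2·g 1` (`g` = exponents listed by rank): `{112} = D(1,1,2)` is incomparable
with `u`; `{112} = T_k(2;1)` before `D(u)` forces `u_k = 3` and the cancellation `2·g 1 < g 0 + g 1` is absurd; after `D(u)` it forces
`u_k ≤ 2`, `u_k = 0` gives `g 1 + g 3 < 2·g 1` (absurd), so `u_k = 1` and the cancellation reads `g 0 + g 3 < 2·g 1`.  Mirror LEMMA Y′: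
`{023}` and `{122}` both carried ⇒ `2·g 2 < g 0 + g 3`.  As `g 1 ≤ g 2`, Y and Y′ cannot both fire: a THIRD multiset is missed ⇒
`n + 1 ≤ 17`.  (This is exactly the sign-free optimum `17` terms of the cell's pairwise DP, now explained face-free; the signed optimum
`16` terms needs the sign rules — NOT claimed.) [cell statement R1624 (a) «conceptual lemma»; folklore-level exchange argument]
-/

set_option linter.dupNamespace false
set_option autoImplicit false

namespace Summit.ValiantsHypothesis.ValiantsHypothesis.Theorems.KPlusLogSqLaw

open Summit.ValiantsHypothesis.ValiantsHypothesis.Theorems.MatrixDescartes.Negative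
open Summit.ValiantsHypothesis.ValiantsHypothesis.Theorems.LacunarySymmetroidMatrixDescartes
open Summit.ValiantsHypothesis.ValiantsHypothesis.Theorems.LacunarySymmetroidMatrixDescartes.TropicalCensus
open Finset

namespace SymmetricThreeFourSixteen

open SymmetricThreeFour SymmetricThreeFourSeventeen

/-! ## The count and the instantiation -/

/-- **CORE (face-free), sixteen.**  Terms `r₀, …, r_n` of `S₃ × (Fin 3 → Fin 4)` with cycle-constant class maps, same-row monotonicity,
pairwise distinct class multisets, a rank-to-exponent list `g` monotone on the occurring classes, and the two CROSSING CANCELLATION rules in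
`g`-form (identity term before / after a crossing term).  Then `n ≤ 16`. [PAIRWISE-CEILING-liftp2g5 §5; counting] -/
theorem core (n : ℕ) (r : Fin (n + 1) → Equiv.Perm (Fin 3) × (Fin 3 → Fin 4)) (g : Fin 4 → ℕ)
    (h1 : ∀ k i, (r k).2 ((r k).1 i) = (r k).2 i)
    (h2 : ∀ a b : Fin (n + 1), a < b → ∀ i, (r a).1 i = (r b).1 i → (r a).2 i ≤ (r b).2 i)
    (h3 : Function.Injective fun k => TropicalCensus.classSym (r k))
    (h6 : ∀ a b : Fin (n + 1), a < b → (r a).1 = 1 → ∀ i j : Fin 3, i ≠ j → (r b).1 i = j → (r b).1 j = i →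
      g ((r a).2 i) + g ((r a).2 j) < 2 * g ((r b).2 i))
    (h7 : ∀ a b : Fin (n + 1), a < b → (r b).1 = 1 → ∀ i j : Fin 3, i ≠ j → (r a).1 i = j → (r a).1 j = i →
      2 * g ((r a).2 i) < g ((r b).2 i) + g ((r b).2 j))
    (h8 : ∀ (a b : Fin (n + 1)) (i j : Fin 3), (r a).2 i ≤ (r b).2 j → g ((r a).2 i) ≤ g ((r b).2 j)) : n ≤ 16 := by
  have X1 := lemmaX1 r g h1 h2 h6 h8
  have X2 := lemmaX2 r g h1 h2 h7 h8
  have Y1 := lemmaY1 r g h1 h2 h6 h7 h8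
  have Y2 := lemmaY2 r g h1 h2 h6 h7 h8
  have hcnt : ∀ (k : Fin (n + 1)) (w : Fin 3 → Fin 4),
      TropicalCensus.classSym (r k) = TropicalCensus.classSym ((1 : Equiv.Perm (Fin 3)), w) →
      ∀ l, (univ.filter fun i => (r k).2 i = l).card = (univ.filter fun i : Fin 3 => w i = l).card :=
    fun k w h l => card_filter_eq_of_classSym_eq h l
  classical
  let P : (Fin 3 → Fin 4) → Sym (Fin 4) 3 := fun w => TropicalCensus.classSym ((1 : Equiv.Perm (Fin 3)), w)
  obtain ⟨X, hX, hXmiss⟩ : ∃ X, (X = P ![0, 0, 3] ∨ X = P ![0, 1, 2]) ∧ ∀ k, TropicalCensus.classSym (r k) ≠ X := by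
    by_cases hA : ∃ a, TropicalCensus.classSym (r a) = P ![0, 0, 3]
    · obtain ⟨a, ha⟩ := hA
      exact ⟨P ![0, 1, 2], Or.inr rfl, fun b hb => X1 a b ha hb⟩
    · push Not at hA
      exact ⟨P ![0, 0, 3], Or.inl rfl, hA⟩
  obtain ⟨Y, hY, hYmiss⟩ : ∃ Y, (Y = P ![0, 3, 3] ∨ Y = P ![1, 2, 3]) ∧ ∀ k, TropicalCensus.classSym (r k) ≠ Y := by
    by_cases hA : ∃ a, TropicalCensus.classSym (r a) = P ![0, 3, 3]
    · obtain ⟨a, ha⟩ := hA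
      exact ⟨P ![1, 2, 3], Or.inr rfl, fun b hb => X2 a b ha hb⟩
    · push Not at hA
      exact ⟨P ![0, 3, 3], Or.inl rfl, hA⟩
  obtain ⟨Z, hZ, hZmiss⟩ : ∃ Z, (Z = P ![0, 1, 3] ∨ Z = P ![1, 1, 2] ∨ Z = P ![0, 2, 3] ∨ Z = P ![1, 2, 2]) ∧
      ∀ k, TropicalCensus.classSym (r k) ≠ Z := by
    by_cases hA : ∃ a, TropicalCensus.classSym (r a) = P ![0, 1, 3]
    · by_cases hB : ∃ b, TropicalCensus.classSym (r b) = P ![1, 1, 2]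
      · by_cases hC : ∃ c, TropicalCensus.classSym (r c) = P ![0, 2, 3]
        · -- Y1 and Y2 would both fire: impossible since g 1 ≤ g 2
          refine ⟨P ![1, 2, 2], Or.inr (Or.inr (Or.inr rfl)), fun e he => ?_⟩
          obtain ⟨a, ha⟩ := hA
          obtain ⟨b, hb⟩ := hB
          obtain ⟨c, hc⟩ := hC
          have y1 := Y1 a b ha hb
          have y2 := Y2 c e hc he
          -- witnesses of classes 1 (in `r a`) and 2 (in `r e`)
          obtain ⟨i, hi⟩ := exists_of_card_pos _ 1 (by rw [(hcnt a _ ha 1).trans (cnt013 1)]; decide)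
          obtain ⟨j, hj⟩ := exists_of_card_pos _ 2 (by rw [(hcnt e _ he 2).trans (cnt122 2)]; decide)
          have g12 := h8 a e i j (by rw [hi, hj]; decide)
          rw [hi, hj] at g12
          omega
        · push Not at hC
          exact ⟨P ![0, 2, 3], Or.inr (Or.inr (Or.inl rfl)), hC⟩
      · push Not at hB
        exact ⟨P ![1, 1, 2], Or.inr (Or.inl rfl), hB⟩
    · push Not at hA
      exact ⟨P ![0, 1, 3], Or.inl rfl, hA⟩
  -- pairwise distinctness of the chosen patterns (distinct count vectors)
  have hXY : X ≠ Y := by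
    rcases hX with rfl | rfl <;> rcases hY with rfl | rfl <;>
      exact fun h => absurd (counts_eq_of_classSym_eq h) (by decide)
  have hXZ : X ≠ Z := by
    rcases hX with rfl | rfl <;> rcases hZ with rfl | rfl | rfl | rfl <;>
      exact fun h => absurd (counts_eq_of_classSym_eq h) (by decide)
  have hYZ : Y ≠ Z := by
    rcases hY with rfl | rfl <;> rcases hZ with rfl | rfl | rfl | rfl <;>
      exact fun h => absurd (counts_eq_of_classSym_eq h) (by decide)
  have hsub : univ.image (fun k => TropicalCensus.classSym (r k)) ⊆ ((univ.erase X).erase Y).erase Z := by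
    intro M hM
    obtain ⟨k, -, rfl⟩ := mem_image.mp hM
    exact mem_erase.mpr ⟨hZmiss k, mem_erase.mpr ⟨hYmiss k, mem_erase.mpr ⟨hXmiss k, mem_univ _⟩⟩⟩
  have hcard := card_le_card hsub
  rw [card_image_of_injective _ h3, card_univ, Fintype.card_fin,
    card_erase_of_mem (mem_erase.mpr ⟨hYZ.symm, mem_erase.mpr ⟨hXZ.symm, mem_univ _⟩⟩),
    card_erase_of_mem (mem_erase.mpr ⟨hXY.symm, mem_univ _⟩), card_erase_of_mem (mem_univ _), card_univ,
    Sym.card_sym_eq_multichoose, Fintype.card_fin] at hcard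
  have h20 : Nat.multichoose 4 3 = 20 := by rw [Nat.multichoose_eq]; rfl
  omega

end SymmetricThreeFourSixteen

open SymmetricThreeFour SymmetricThreeFourSeventeen SymmetricThreeFourSixteen

/-- **`T_sym(3,4) ≤ 16` ON EVERY SUPPORT.**  A SYMMETRIC `3 × 3` dominance design with four slope classes (symmetric valuations and
signs; any exponents `d`) has at most `16` sign-alternating uniquely dominant breakpoints along increasing integer slopes.  Face-free proof:
three of the twenty class multisets are always missed (`{0,0,3}`/`{0,1,2}`, `{0,3,3}`/`{1,2,3}`, and one of `{0,1,3}`/`{1,1,2}`,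
`{0,2,3}`/`{1,2,2}` according as `d₀ + d₃ ≥ 2d₁` or `d₀ + d₃ ≤ 2d₂`), by the exchange rules `d_lt_of_dominant_entry` and
`d_add_d_lt_of_dominant_cross`.  Improves the kernel ceilings `18` (p459728) and `17` (`…Seventeen`); the floor is `15` (p469079).
[cell statement R1624 (a); folklore-level exchange argument] -/
theorem tropRow_three_four_symm_le_sixteen (d : Fin 4 → ℕ) (v ε : Fin 3 → Fin 3 → Fin 4 → ℤ)
    (hv : ∀ i j l, v i j l = v j i l) (hεs : ∀ i j l, ε i j l = ε j i l)
    (n : ℕ) (θ : Fin (n + 1) → ℤ) (p : Fin (n + 1) → Equiv.Perm (Fin 3) × (Fin 3 → Fin 4))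
    (hθ : StrictMono θ) (hdom : ∀ k, IsDominant d v ε (θ k) (p k))
    (halt : ∀ k : Fin n, termSign ε (p k.castSucc) * termSign ε (p k.succ) < 0) : n ≤ 16 := by
  have hinj : Function.Injective p := stub_dominantInjective 3 4 d v ε n θ p hθ hdom halt
  obtain ⟨ρ, hρ⟩ : ∃ ρ : Fin 4 → Fin 4, ∀ l, (ρ l : ℕ) = dRank d l :=
    ⟨fun l => ⟨dRank d l, lt_of_le_of_lt (dRank_le d l) (by norm_num)⟩, fun _ => rfl⟩
  have hρeq : ∀ {l l' : Fin 4}, ρ l = ρ l' → d l = d l' := fun {l l'} h =>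
    d_eq_of_dRank_eq d (by rw [← hρ, ← hρ, h])
  have hρle : ∀ {l l' : Fin 4}, d l < d l' → ρ l ≤ ρ l' := fun {l l'} h => by
    rw [Fin.le_iff_val_le_val, hρ, hρ]
    exact (dRank_lt_of_lt d h).le
  have hρmono : ∀ {l l' : Fin 4}, ρ l ≤ ρ l' → d l ≤ d l' := fun {l l'} h => by
    by_contra hlt
    have h1 := dRank_lt_of_lt d (not_le.mp hlt)
    rw [← hρ, ← hρ] at h1
    exact absurd h (not_le.mpr (Fin.lt_def.mpr h1))
  -- the rank-to-exponent list `g`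
  classical
  obtain ⟨g, hg⟩ : ∃ g : Fin 4 → ℕ, ∀ l, g (ρ l) = d l := by
    refine ⟨fun s => if h : ∃ l, ρ l = s then d h.choose else 0, fun l => ?_⟩
    have h : ∃ l', ρ l' = ρ l := ⟨l, rfl⟩
    dsimp only
    rw [dif_pos h]
    exact hρeq h.choose_spec
  -- cycle-constancy of every dominant term (symmetry)
  have hcc : ∀ k i, (p k).2 ((p k).1 i) = (p k).2 i := fun k i =>
    (isDominant_symm_involutive d v ε hv hεs (θ k) (p k).1 (p k).2 (hdom k)).2 i
  refine SymmetricThreeFourSixteen.core n (fun k => ((p k).1, fun i => ρ ((p k).2 i))) g (fun k i => ?_) (fun a b hab i hσ => ?_) ?_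
    (fun a b hab ha1 i j hij hbi hbj => ?_) (fun a b hab hb1 i j hij hai haj => ?_) (fun a b i j hle => ?_)
  · show ρ ((p k).2 ((p k).1 i)) = ρ ((p k).2 i)
    rw [hcc]
  · change (p a).1 i = (p b).1 i at hσ
    show ρ ((p a).2 i) ≤ ρ ((p b).2 i)
    by_cases h : (p a).2 i = (p b).2 i
    · rw [h]
    · exact hρle (d_lt_of_dominant_entry d v ε (hθ hab) (p a).1 (p b).1 (p a).2 (p b).2 (hdom a) (hdom b) i hσ h)
  · -- distinct rank multisets
    have hslope : ∀ k, TropicalCensus.slope d (p k) = TropicalCensus.slope g ((p k).1, fun i => ρ ((p k).2 i)) := by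
      intro k
      unfold TropicalCensus.slope
      simp only [hg]
    have key : ∀ a b : Fin (n + 1), a < b →
        TropicalCensus.classSym ((p a).1, fun i => ρ ((p a).2 i)) ≠
          TropicalCensus.classSym ((p b).1, fun i => ρ ((p b).2 i)) := by
      intro a b hlt heq
      have h1 := slope_lt_of_dominant d v ε (hθ hlt) (fun e => (ne_of_lt hlt) (hinj e)) (hdom a) (hdom b)
      rw [hslope, hslope, slope_eq_of_classSym, slope_eq_of_classSym, heq] at h1
      exact lt_irrefl _ h1
    intro a b hab
    change TropicalCensus.classSym ((p a).1, fun i => ρ ((p a).2 i)) =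
      TropicalCensus.classSym ((p b).1, fun i => ρ ((p b).2 i)) at hab
    rcases lt_trichotomy a b with h | h | h
    · exact absurd hab (key a b h)
    · exact h
    · exact absurd hab.symm (key b a h)
  · -- identity term before a crossing term: cancellation (C)
    change (p a).1 = 1 at ha1
    change (p b).1 i = j at hbi
    change (p b).1 j = i at hbj
    show g (ρ ((p a).2 i)) + g (ρ ((p a).2 j)) < 2 * g (ρ ((p b).2 i))
    rw [hg, hg, hg]
    have hDa : IsDominant d v ε (θ a) (1, (p a).2) := by rw [← ha1]; exact hdom a
    have hC := d_add_d_lt_of_dominant_cross d v ε (hθ hab) 1 (p b).1 (p a).2 (p b).2 hDa (hdom b) hij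
      (by rw [hbi, Equiv.Perm.one_apply]) (by rw [hbj, Equiv.Perm.one_apply])
    have hji : (p b).2 j = (p b).2 i := by rw [← hbi, hcc]
    rw [hji] at hC
    omega
  · -- crossing term before an identity term
    change (p b).1 = 1 at hb1
    change (p a).1 i = j at hai
    change (p a).1 j = i at haj
    show 2 * g (ρ ((p a).2 i)) < g (ρ ((p b).2 i)) + g (ρ ((p b).2 j))
    rw [hg, hg, hg]
    have hDb : IsDominant d v ε (θ b) (1, (p b).2) := by rw [← hb1]; exact hdom b
    have hC := d_add_d_lt_of_dominant_cross d v ε (hθ hab) (p a).1 1 (p a).2 (p b).2 (hdom a) hDb hij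
      (by rw [haj, Equiv.Perm.one_apply]) (by rw [hai, Equiv.Perm.one_apply])
    have hji : (p a).2 j = (p a).2 i := by rw [← hai, hcc]
    rw [hji] at hC
    omega
  · -- `g` is monotone on occurring classes
    change ρ ((p a).2 i) ≤ ρ ((p b).2 j) at hle
    show g (ρ ((p a).2 i)) ≤ g (ρ ((p b).2 j))
    rw [hg, hg]
    exact hρmono hle

/-- **`TropRootLawAtSymm 3 4 16`** — the kernel window for the symmetric single-term `(3,4)` row becomes `[15, 16]`. [restatement] -/
theorem tropRootLawAtSymm_three_four_sixteen : Orbit.TropRootLawAtSymm 3 4 16 :=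
  fun d v ε hv hε n θ p hθ hdom halt => tropRow_three_four_symm_le_sixteen d v ε hv hε n θ p hθ hdom halt

end Summit.ValiantsHypothesis.ValiantsHypothesis.Theorems.KPlusLogSqLaw
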